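import Literature.MathematicalPhysics.QuantumLattice.GibbsSectorWeightTransfer
import Literature.MathematicalPhysics.QuantumLattice.HubbardCanonicalSusceptibilityBounds
import Literature.MathematicalPhysics.QuantumLattice.CanonicalPartitionFnAdjacentSectors
import Literature.MathematicalPhysics.QuantumLattice.HubbardTTPrimeThermalPressureLimit
import HarnessLib

/-!
# Log-Lipschitz continuity of the spin-sector canonical partition functions in the particle numbers
# (spin-resolved orbit-sum transfer; sharp free-fermion entropy factor)

Topic `MathematicalPhysics/QuantumLattice` (family `hubbard`); the SPIN-RESOLVED form of
`GibbsSectorWeightTransfer.lean` (which treats the total particle number) and the SHARP form of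
`CanonicalPartitionFnAdjacentSectors.lean` (whose Peierls argument in `H|_{p'} ⊗ 1_Λ` loses a factor `|Λ|` per
added electron — harmless for `O(1)` electrons, fatal for `O(|Λ|)`). For a Hermitian matrix `H` on the Hubbard
Fock space over the sites `Λ` which conserves `N↑` and `N↓` (`PreservesSectors H`) and has bounded commutators
with the single fermion operators, `‖[H, c†_{xσ}]‖ ≤ r`, the canonical partition functions
`Z(a, b) = Re Z_β(H|_{(a,b)})` of the spin sectors satisfy, at `β ≥ 0` and `a < |Λ|`,

`(|Λ| − a) Z(a, b) ≤ e^{β|Λ|r/(|Λ|−a)} (a+1) Z(a+1, b)`,  `(a+1) Z(a+1, b) ≤ e^{β|Λ|r/(a+1)} (|Λ| − a) Z(a, b)`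

(`partitionFn_spinSector_transfer_up`; `…_down` for `b ↦ b+1`): up to the factors `e^{O(β)}` the ratio
`Z(a+1,b)/Z(a,b)` is the free-fermion value `(|Λ|−a)/(a+1)` — the finite-temperature, canonical form of the
statement that adding one electron changes the free energy by the ideal-gas entropy `log((|Λ|−a)/(a+1))` plus
`O(1)` (Ruelle 1969 §3.4; Bratteli–Robinson II §5.2–5.3, §6.2.4). The proof is the tree's abstract orbit-sum
transfer `orbitSum_transfer_gibbsWeight` (Peierls–Jensen in an eigenbasis of `H` for the trial vectors
`c†_{x↑} P u_i`, summed with a frame identity) with the projection `P = P_{a,b}` (`spinSectorProj`) and the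
trial maps `c†_{x↑}` (resp. `c_{x↑}`), plus the spin-resolved CAR bookkeeping proved in §1, and the dictionary
`Tr[P_{a,b} e^{−βH}] = Z_β(H|_{(a,b)})` (`trace_spinSectorProj_mul_gibbsWeight`).

* §1 `P_{a,b} c_{x↑} = c_{x↑} P_{a+1,b}`, `P_{a+1,b} c†_{x↑} = c†_{x↑} P_{a,b}` (and `↓`), `Σ_x n_{xσ} = diag(N_σ)`,
  the weight identities `(Σ_x c_{x↑} c†_{x↑}) P_{a,b} = (|Λ|−a) P_{a,b}`, `(Σ_x c†_{x↑} c_{x↑}) P_{a+1,b} = (a+1) P_{a+1,b}`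
  and the frame identities `Σ_x c†_{x↑} P_{a,b} c_{x↑} = (a+1) P_{a+1,b}`, `Σ_x c_{x↑} P_{a+1,b} c†_{x↑} = (|Λ|−a) P_{a,b}`;
* §2 `partitionFn_spinSector_transfer_up/_down` (general sector-preserving Hermitian `H`);
* §3 the two-graph Hubbard Hamiltonian `hamiltonian G t U + hamiltonian G' t' U'` of degrees `≤ Δ, Δ'`
  (`r = 2(2Δ+1)(2|t|+|U|) + 2(2Δ'+1)(2|t'|+|U'|)`, `norm_commutator_twoGraph_creation_le`) and the `t–t'` torus
  `hubbardRectTorusTT' a b t t' U` (`Δ = Δ' = 4`, `r = 18(2|t|+|U|) + 36|t'|`), in product and in logarithmic form: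
  `|log Z(k+1,l) − log Z(k,l) − log((|Λ|−k)/(k+1))| ≤ β|Λ|r · max(1/(|Λ|−k), 1/(k+1))`.

Everything is PROVED; no definition, no named fact.

## Mathlib / tree search

REUSED: `orbitSum_transfer_gibbsWeight`, `re_star_dotProduct_sum_commutator_mulVec_le` (`GibbsSectorWeightTransfer`);
`spinSectorProj`, `spinSectorProj_mul_self`, `spinSectorProj_conjTranspose` (`HubbardCanonicalGaussianDomination`);
`trace_spinSectorProj_mul_gibbsWeight` (`HubbardCanonicalSusceptibilityBounds`); `annihilation_apply`,
`annihilation_mul_creation_add_creation_mul_annihilation_holds`, `numberAt_eq_diagonal`, `pairSet_insert_zero/one`,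
`norm_creation_le_one`, `norm_annihilation_le_one`; `norm_commutator_twoGraph_creation_le`,
`card_filter_fermionRectTorusGraph_adj_le`, `card_filter_fermionRectTorusDiagGraph_adj_le_four`
(`HubbardTTPrimeThermalPressureLimit`). `lean search
'spinSectorProj.*annihilation|transfer_up'`: nothing (2026-08-27).

## References

* D. Ruelle, *Statistical Mechanics: Rigorous Results* (1969), §3.4. [cite: Ruelle1969, §3.4]
* O. Bratteli, D. W. Robinson, *Operator Algebras and Quantum Statistical Mechanics 2* (1997), §5.2.2, §6.2.4.
  [cite: BratteliRobinsonII1997, §6.2.4]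
-/

noncomputable section

namespace Literature.MathematicalPhysics.QuantumLattice

open Matrix Finset HubbardWave0 LiebThm1 ThermodynamicLimit
open scoped ComplexOrder BigOperators Matrix.Norms.L2Operator

/-! ### §1 Spin-resolved CAR bookkeeping with the sector projections `P_{a,b}` -/

section CAR

variable {Λ : Type*} [LinearOrder Λ] [Fintype Λ]

/-- `P_{a,b} c_{x↑} = c_{x↑} P_{a+1,b}`: annihilating an up electron lowers `N↑` by one. [cite: Ruelle1969, §3.4] -/
theorem spinSectorProj_mul_annihilation_up (a b : ℕ) (x : Λ) :
    (spinSectorProj a b : Matrix (Finset (Orb Λ)) _ ℂ) * annihilation (orb x 0) =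
      annihilation (orb x 0) * spinSectorProj (a + 1) b := by
  ext s u
  rw [spinSectorProj, spinSectorProj, diagonal_mul, mul_diagonal, annihilation_apply]
  by_cases h : orb x 0 ∉ s ∧ u = insert (orb x 0) s
  · rw [if_pos h]
    obtain ⟨hx, rfl⟩ := h
    obtain ⟨α, γ, rfl⟩ : ∃ α γ, s = pairSet α γ := ⟨upPart s, downPart s, (pairSet_upPart_downPart s).symm⟩
    rw [orb_zero_mem_pairSet] at hx
    rw [pairSet_insert_zero, upPart_pairSet, downPart_pairSet, upPart_pairSet, downPart_pairSet,
      Finset.card_insert_of_notMem hx]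
    by_cases hab : α.card = a ∧ γ.card = b
    · rw [if_pos hab, if_pos ⟨by rw [hab.1], hab.2⟩, one_mul, mul_one]
    · rw [if_neg hab, if_neg (fun h' => hab ⟨by omega, h'.2⟩), zero_mul, mul_zero]
  · rw [if_neg h, mul_zero, zero_mul]

/-- `P_{a,b} c_{x↓} = c_{x↓} P_{a,b+1}`: annihilating a down electron lowers `N↓` by one. [cite: Ruelle1969, §3.4] -/
theorem spinSectorProj_mul_annihilation_down (a b : ℕ) (x : Λ) :
    (spinSectorProj a b : Matrix (Finset (Orb Λ)) _ ℂ) * annihilation (orb x 1) =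
      annihilation (orb x 1) * spinSectorProj a (b + 1) := by
  ext s u
  rw [spinSectorProj, spinSectorProj, diagonal_mul, mul_diagonal, annihilation_apply]
  by_cases h : orb x 1 ∉ s ∧ u = insert (orb x 1) s
  · rw [if_pos h]
    obtain ⟨hx, rfl⟩ := h
    obtain ⟨α, γ, rfl⟩ : ∃ α γ, s = pairSet α γ := ⟨upPart s, downPart s, (pairSet_upPart_downPart s).symm⟩
    rw [orb_one_mem_pairSet] at hx
    rw [pairSet_insert_one, upPart_pairSet, downPart_pairSet, upPart_pairSet, downPart_pairSet,
      Finset.card_insert_of_notMem hx]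
    by_cases hab : α.card = a ∧ γ.card = b
    · rw [if_pos hab, if_pos ⟨hab.1, by rw [hab.2]⟩, one_mul, mul_one]
    · rw [if_neg hab, if_neg (fun h' => hab ⟨h'.1, by omega⟩), zero_mul, mul_zero]
  · rw [if_neg h, mul_zero, zero_mul]

/-- `P_{a+1,b} c†_{x↑} = c†_{x↑} P_{a,b}` (adjoint of `spinSectorProj_mul_annihilation_up`). [cite: Ruelle1969, §3.4] -/
theorem spinSectorProj_succ_mul_creation_up (a b : ℕ) (x : Λ) :
    (spinSectorProj (a + 1) b : Matrix (Finset (Orb Λ)) _ ℂ) * creation (orb x 0) =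
      creation (orb x 0) * spinSectorProj a b := by
  have h := congrArg conjTranspose (spinSectorProj_mul_annihilation_up a b x)
  rw [conjTranspose_mul, conjTranspose_mul, spinSectorProj_conjTranspose, spinSectorProj_conjTranspose,
    annihilation_conjTranspose] at h
  exact h.symm

/-- `P_{a,b+1} c†_{x↓} = c†_{x↓} P_{a,b}` (adjoint of `spinSectorProj_mul_annihilation_down`). [cite: Ruelle1969, §3.4] -/
theorem spinSectorProj_succ_mul_creation_down (a b : ℕ) (x : Λ) :
    (spinSectorProj a (b + 1) : Matrix (Finset (Orb Λ)) _ ℂ) * creation (orb x 1) =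
      creation (orb x 1) * spinSectorProj a b := by
  have h := congrArg conjTranspose (spinSectorProj_mul_annihilation_down a b x)
  rw [conjTranspose_mul, conjTranspose_mul, spinSectorProj_conjTranspose, spinSectorProj_conjTranspose,
    annihilation_conjTranspose] at h
  exact h.symm

/-- `Σ_x n_{x↑} = diag(N↑)`, `N↑(s) = |upPart s|`. [cite: Ruelle1969, §3.4] -/
theorem sum_numberAt_up_eq_diagonal :
    ∑ x : Λ, numberAt (orb x 0) = diagonal fun s : Finset (Orb Λ) => ((upPart s).card : ℂ) := by
  ext s u
  rw [Matrix.sum_apply, diagonal_apply]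
  simp_rw [numberAt_eq_diagonal, diagonal_apply]
  by_cases hsu : s = u
  · subst hsu
    simp only [if_true]
    rw [Finset.sum_boole]
    rfl
  · simp [hsu]

/-- `Σ_x n_{x↓} = diag(N↓)`, `N↓(s) = |downPart s|`. [cite: Ruelle1969, §3.4] -/
theorem sum_numberAt_down_eq_diagonal :
    ∑ x : Λ, numberAt (orb x 1) = diagonal fun s : Finset (Orb Λ) => ((downPart s).card : ℂ) := by
  ext s u
  rw [Matrix.sum_apply, diagonal_apply]
  simp_rw [numberAt_eq_diagonal, diagonal_apply]
  by_cases hsu : s = u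
  · subst hsu
    simp only [if_true]
    rw [Finset.sum_boole]
    rfl
  · simp [hsu]

/-- `N↑ P_{a,b} = a P_{a,b}`. [cite: Ruelle1969, §3.4] -/
theorem sum_numberAt_up_mul_spinSectorProj (a b : ℕ) :
    (∑ x : Λ, numberAt (orb x 0)) * spinSectorProj a b = (a : ℂ) • (spinSectorProj a b : Matrix (Finset (Orb Λ)) _ ℂ) := by
  rw [sum_numberAt_up_eq_diagonal, spinSectorProj, diagonal_mul_diagonal, ← diagonal_smul]
  congr 1
  funext s
  simp only [Pi.smul_apply, smul_eq_mul]
  split_ifs with h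
  · rw [h.1]
  · simp

/-- `N↓ P_{a,b} = b P_{a,b}`. [cite: Ruelle1969, §3.4] -/
theorem sum_numberAt_down_mul_spinSectorProj (a b : ℕ) :
    (∑ x : Λ, numberAt (orb x 1)) * spinSectorProj a b = (b : ℂ) • (spinSectorProj a b : Matrix (Finset (Orb Λ)) _ ℂ) := by
  rw [sum_numberAt_down_eq_diagonal, spinSectorProj, diagonal_mul_diagonal, ← diagonal_smul]
  congr 1
  funext s
  simp only [Pi.smul_apply, smul_eq_mul]
  split_ifs with h
  · rw [h.2]
  · simp

/-- `Σ_x c_{xσ} c†_{xσ} = |Λ|·1 − Σ_x n_{xσ}` (CAR). [cite: BratteliRobinsonII1997, §5.2.2 (5.2.11)] -/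
theorem sum_annihilation_mul_creation_orb (σ : Fin 2) :
    ∑ x : Λ, annihilation (orb x σ) * creation (orb x σ) =
      (Fintype.card Λ : ℂ) • (1 : Matrix (Finset (Orb Λ)) (Finset (Orb Λ)) ℂ) - ∑ x : Λ, numberAt (orb x σ) := by
  have hCAR := annihilation_mul_creation_add_creation_mul_annihilation_holds (ι := Orb Λ)
  have h1 : ∀ x : Λ, annihilation (orb x σ) * creation (orb x σ) = 1 - numberAt (orb x σ) := fun x => by
    rw [eq_sub_iff_add_eq, numberAt]
    have h := hCAR (orb x σ) (orb x σ)
    rwa [if_pos rfl] at h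
  simp only [h1, Finset.sum_sub_distrib, Finset.sum_const, Finset.card_univ]
  rw [← Nat.cast_smul_eq_nsmul ℂ]

/-- **Weight identity, adding an up electron**: `(Σ_x c_{x↑} c†_{x↑}) P_{a,b} = (|Λ| − a) P_{a,b}`.
[cite: Ruelle1969, §3.4] -/
theorem sum_creation_up_conjTranspose_mul_mul_spinSectorProj (a b : ℕ) :
    (∑ x : Λ, (creation (orb x 0))ᴴ * creation (orb x 0)) * spinSectorProj a b =
      ((((Fintype.card Λ : ℝ) - a : ℝ)) : ℂ) • (spinSectorProj a b : Matrix (Finset (Orb Λ)) _ ℂ) := by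
  simp only [creation_conjTranspose]
  rw [sum_annihilation_mul_creation_orb, Matrix.sub_mul, Matrix.smul_mul, Matrix.one_mul,
    sum_numberAt_up_mul_spinSectorProj, ← sub_smul]
  congr 1
  push_cast
  ring

/-- **Weight identity, adding a down electron**: `(Σ_x c_{x↓} c†_{x↓}) P_{a,b} = (|Λ| − b) P_{a,b}`.
[cite: Ruelle1969, §3.4] -/
theorem sum_creation_down_conjTranspose_mul_mul_spinSectorProj (a b : ℕ) :
    (∑ x : Λ, (creation (orb x 1))ᴴ * creation (orb x 1)) * spinSectorProj a b =
      ((((Fintype.card Λ : ℝ) - b : ℝ)) : ℂ) • (spinSectorProj a b : Matrix (Finset (Orb Λ)) _ ℂ) := by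
  simp only [creation_conjTranspose]
  rw [sum_annihilation_mul_creation_orb, Matrix.sub_mul, Matrix.smul_mul, Matrix.one_mul,
    sum_numberAt_down_mul_spinSectorProj, ← sub_smul]
  congr 1
  push_cast
  ring

/-- **Weight identity, removing an up electron**: `(Σ_x c†_{x↑} c_{x↑}) P_{a+1,b} = (a+1) P_{a+1,b}`.
[cite: Ruelle1969, §3.4] -/
theorem sum_annihilation_up_conjTranspose_mul_mul_spinSectorProj (a b : ℕ) :
    (∑ x : Λ, (annihilation (orb x 0))ᴴ * annihilation (orb x 0)) * spinSectorProj (a + 1) b =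
      ((((a : ℝ) + 1 : ℝ)) : ℂ) • (spinSectorProj (a + 1) b : Matrix (Finset (Orb Λ)) _ ℂ) := by
  simp only [annihilation_conjTranspose]
  rw [show ∑ x : Λ, creation (orb x 0) * annihilation (orb x 0) = ∑ x : Λ, numberAt (orb x 0) from rfl,
    sum_numberAt_up_mul_spinSectorProj]
  congr 1
  push_cast
  ring

/-- **Weight identity, removing a down electron**: `(Σ_x c†_{x↓} c_{x↓}) P_{a,b+1} = (b+1) P_{a,b+1}`.
[cite: Ruelle1969, §3.4] -/
theorem sum_annihilation_down_conjTranspose_mul_mul_spinSectorProj (a b : ℕ) :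
    (∑ x : Λ, (annihilation (orb x 1))ᴴ * annihilation (orb x 1)) * spinSectorProj a (b + 1) =
      ((((b : ℝ) + 1 : ℝ)) : ℂ) • (spinSectorProj a (b + 1) : Matrix (Finset (Orb Λ)) _ ℂ) := by
  simp only [annihilation_conjTranspose]
  rw [show ∑ x : Λ, creation (orb x 1) * annihilation (orb x 1) = ∑ x : Λ, numberAt (orb x 1) from rfl,
    sum_numberAt_down_mul_spinSectorProj]
  congr 1
  push_cast
  ring

/-- **Frame identity, adding an up electron**: `Σ_x c†_{x↑} P_{a,b} c_{x↑} = (a+1) P_{a+1,b}`.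
[cite: Ruelle1969, §3.4] -/
theorem sum_creation_up_mul_spinSectorProj_mul_conjTranspose (a b : ℕ) :
    ∑ x : Λ, creation (orb x 0) * spinSectorProj a b * (creation (orb x 0))ᴴ =
      ((((a : ℝ) + 1 : ℝ)) : ℂ) • (spinSectorProj (a + 1) b : Matrix (Finset (Orb Λ)) _ ℂ) := by
  have h : ∀ x : Λ, creation (orb x 0) * spinSectorProj a b * (creation (orb x 0))ᴴ =
      numberAt (orb x 0) * spinSectorProj (a + 1) b := fun x => by
    rw [creation_conjTranspose, Matrix.mul_assoc, spinSectorProj_mul_annihilation_up, ← Matrix.mul_assoc, numberAt]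
  simp only [h, ← Finset.sum_mul]
  rw [sum_numberAt_up_mul_spinSectorProj]
  congr 1
  push_cast
  ring

/-- **Frame identity, adding a down electron**: `Σ_x c†_{x↓} P_{a,b} c_{x↓} = (b+1) P_{a,b+1}`.
[cite: Ruelle1969, §3.4] -/
theorem sum_creation_down_mul_spinSectorProj_mul_conjTranspose (a b : ℕ) :
    ∑ x : Λ, creation (orb x 1) * spinSectorProj a b * (creation (orb x 1))ᴴ =
      ((((b : ℝ) + 1 : ℝ)) : ℂ) • (spinSectorProj a (b + 1) : Matrix (Finset (Orb Λ)) _ ℂ) := by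
  have h : ∀ x : Λ, creation (orb x 1) * spinSectorProj a b * (creation (orb x 1))ᴴ =
      numberAt (orb x 1) * spinSectorProj a (b + 1) := fun x => by
    rw [creation_conjTranspose, Matrix.mul_assoc, spinSectorProj_mul_annihilation_down, ← Matrix.mul_assoc, numberAt]
  simp only [h, ← Finset.sum_mul]
  rw [sum_numberAt_down_mul_spinSectorProj]
  congr 1
  push_cast
  ring

/-- **Frame identity, removing an up electron**: `Σ_x c_{x↑} P_{a+1,b} c†_{x↑} = (|Λ| − a) P_{a,b}`.
[cite: Ruelle1969, §3.4] -/
theorem sum_annihilation_up_mul_spinSectorProj_mul_conjTranspose (a b : ℕ) :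
    ∑ x : Λ, annihilation (orb x 0) * spinSectorProj (a + 1) b * (annihilation (orb x 0))ᴴ =
      ((((Fintype.card Λ : ℝ) - a : ℝ)) : ℂ) • (spinSectorProj a b : Matrix (Finset (Orb Λ)) _ ℂ) := by
  have h : ∀ x : Λ, annihilation (orb x 0) * spinSectorProj (a + 1) b * (annihilation (orb x 0))ᴴ =
      annihilation (orb x 0) * creation (orb x 0) * spinSectorProj a b := fun x => by
    rw [annihilation_conjTranspose, Matrix.mul_assoc, spinSectorProj_succ_mul_creation_up, ← Matrix.mul_assoc]
  simp only [h, ← Finset.sum_mul]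
  rw [sum_annihilation_mul_creation_orb, Matrix.sub_mul, Matrix.smul_mul, Matrix.one_mul,
    sum_numberAt_up_mul_spinSectorProj, ← sub_smul]
  congr 1
  push_cast
  ring

/-- **Frame identity, removing a down electron**: `Σ_x c_{x↓} P_{a,b+1} c†_{x↓} = (|Λ| − b) P_{a,b}`.
[cite: Ruelle1969, §3.4] -/
theorem sum_annihilation_down_mul_spinSectorProj_mul_conjTranspose (a b : ℕ) :
    ∑ x : Λ, annihilation (orb x 1) * spinSectorProj a (b + 1) * (annihilation (orb x 1))ᴴ =
      ((((Fintype.card Λ : ℝ) - b : ℝ)) : ℂ) • (spinSectorProj a b : Matrix (Finset (Orb Λ)) _ ℂ) := by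
  have h : ∀ x : Λ, annihilation (orb x 1) * spinSectorProj a (b + 1) * (annihilation (orb x 1))ᴴ =
      annihilation (orb x 1) * creation (orb x 1) * spinSectorProj a b := fun x => by
    rw [annihilation_conjTranspose, Matrix.mul_assoc, spinSectorProj_succ_mul_creation_down, ← Matrix.mul_assoc]
  simp only [h, ← Finset.sum_mul]
  rw [sum_annihilation_mul_creation_orb, Matrix.sub_mul, Matrix.smul_mul, Matrix.one_mul,
    sum_numberAt_down_mul_spinSectorProj, ← sub_smul]
  congr 1
  push_cast
  ring

/-- A sector-preserving matrix commutes with the sector projections: `P_{a,b} H = H P_{a,b}`.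
[cite: LiebPRL1989, Remark (2)] -/
theorem spinSectorProj_mul_comm_of_preservesSectors {H : Matrix (Finset (Orb Λ)) (Finset (Orb Λ)) ℂ}
    (hH : PreservesSectors H) (a b : ℕ) : spinSectorProj a b * H = H * spinSectorProj a b := by
  ext s u
  rw [spinSectorProj, diagonal_mul, mul_diagonal]
  by_cases h : H s u = 0
  · rw [h, mul_zero, zero_mul]
  · obtain ⟨h1, h2⟩ := hH s u h
    rw [h1, h2, mul_comm]

/-- The dictionary `Re Tr[P_{a,b} e^{−βH}] = Re Z_β(H|_{(a,b)})` for a sector-preserving `H`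
(`trace_spinSectorProj_mul_gibbsWeight` in the `spinSectorHamiltonian` spelling). [cite: LiebPRL1989, proof of Theorem 1] -/
theorem re_trace_spinSectorProj_mul_gibbsWeight_eq {H : Matrix (Finset (Orb Λ)) (Finset (Orb Λ)) ℂ}
    (hH : PreservesSectors H) (β : ℝ) (a b : ℕ) :
    ((spinSectorProj a b * gibbsWeight β H).trace).re = (partitionFn β (spinSectorHamiltonian a b H)).re := by
  rw [trace_spinSectorProj_mul_gibbsWeight hH β (spinConfig a b) (fun s => Iff.rfl)]
  rfl

/-- `‖[H, c_o]‖ = ‖[H, c†_o]‖` for Hermitian `H` (adjoint). [cite: BratteliRobinsonII1997, §5.2.2] -/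
theorem norm_commutator_annihilation_le_of_creation {H : Matrix (Finset (Orb Λ)) (Finset (Orb Λ)) ℂ}
    (hH : H.IsHermitian) (o : Orb Λ) {r : ℝ} (hc : ‖H * creation o - creation o * H‖ ≤ r) :
    ‖H * annihilation o - annihilation o * H‖ ≤ r := by
  have h : H * annihilation o - annihilation o * H = -(H * creation o - creation o * H)ᴴ := by
    rw [conjTranspose_sub, conjTranspose_mul, conjTranspose_mul, creation_conjTranspose, hH.eq, neg_sub]
  rw [h, norm_neg, Matrix.l2_opNorm_conjTranspose]
  exact hc

end CAR

/-! ### §2 The transfer inequalities for a sector-preserving Hermitian `H` -/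

section Transfer

variable {Λ : Type*} [LinearOrder Λ] [Fintype Λ]

/-- **Spin-up transfer.** For a Hermitian, sector-preserving `H` on the Hubbard Fock space over `Λ` with
`‖[H, c†_{x↑}]‖ ≤ r` for all sites `x`, `β ≥ 0` and `a < |Λ|`:
`(|Λ| − a) Re Z_β(H; a, b) ≤ e^{β|Λ|r/(|Λ|−a)} (a+1) Re Z_β(H; a+1, b)` and
`(a+1) Re Z_β(H; a+1, b) ≤ e^{β|Λ|r/(a+1)} (|Λ| − a) Re Z_β(H; a, b)`. [cite: Ruelle1969, §3.4]
[cite: BratteliRobinsonII1997, §6.2.4] -/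
theorem partitionFn_spinSector_transfer_up {H : Matrix (Finset (Orb Λ)) (Finset (Orb Λ)) ℂ}
    (hH : H.IsHermitian) (hP : PreservesSectors H) {r β : ℝ} (hβ : 0 ≤ β)
    (hc : ∀ x : Λ, ‖H * creation (orb x 0) - creation (orb x 0) * H‖ ≤ r) {a : ℕ}
    (ha : a < Fintype.card Λ) (b : ℕ) :
    ((Fintype.card Λ : ℝ) - a) * (partitionFn β (spinSectorHamiltonian a b H)).re ≤
        Real.exp (β * (Fintype.card Λ * r) / ((Fintype.card Λ : ℝ) - a)) *
          (((a : ℝ) + 1) * (partitionFn β (spinSectorHamiltonian (a + 1) b H)).re) ∧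
      ((a : ℝ) + 1) * (partitionFn β (spinSectorHamiltonian (a + 1) b H)).re ≤
        Real.exp (β * (Fintype.card Λ * r) / ((a : ℝ) + 1)) *
          (((Fintype.card Λ : ℝ) - a) * (partitionFn β (spinSectorHamiltonian a b H)).re) := by
  have ha0 : (0 : ℝ) < (Fintype.card Λ : ℝ) - a := by
    have : (a : ℝ) + 1 ≤ Fintype.card Λ := by exact_mod_cast ha
    linarith
  have hann : ∀ x : Λ, ‖H * annihilation (orb x 0) - annihilation (orb x 0) * H‖ ≤ r := fun x =>
    norm_commutator_annihilation_le_of_creation hH _ (hc x)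
  refine ⟨?_, ?_⟩
  · have h := orbitSum_transfer_gibbsWeight (O := Λ) hH (spinSectorProj_conjTranspose a b)
      (spinSectorProj_mul_self a b) (spinSectorProj_mul_comm_of_preservesSectors hP a b)
      (fun x => creation (orb x 0)) ha0 hβ (ρ := Fintype.card Λ * r)
      (sum_creation_up_conjTranspose_mul_mul_spinSectorProj a b)
      (fun v => re_star_dotProduct_sum_commutator_mulVec_le H (fun x => creation (orb x 0))
        (fun x => norm_creation_le_one _) hc _)
    rw [sum_creation_up_mul_spinSectorProj_mul_conjTranspose, Matrix.smul_mul, Matrix.trace_smul, smul_eq_mul,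
      Complex.re_ofReal_mul, re_trace_spinSectorProj_mul_gibbsWeight_eq hP,
      re_trace_spinSectorProj_mul_gibbsWeight_eq hP] at h
    exact h
  · have ha1 : (0 : ℝ) < (a : ℝ) + 1 := by positivity
    have h := orbitSum_transfer_gibbsWeight (O := Λ) hH (spinSectorProj_conjTranspose (a + 1) b)
      (spinSectorProj_mul_self (a + 1) b) (spinSectorProj_mul_comm_of_preservesSectors hP (a + 1) b)
      (fun x => annihilation (orb x 0)) ha1 hβ (ρ := Fintype.card Λ * r)
      (sum_annihilation_up_conjTranspose_mul_mul_spinSectorProj a b)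
      (fun v => re_star_dotProduct_sum_commutator_mulVec_le H (fun x => annihilation (orb x 0))
        (fun x => norm_annihilation_le_one _) hann _)
    rw [sum_annihilation_up_mul_spinSectorProj_mul_conjTranspose, Matrix.smul_mul, Matrix.trace_smul, smul_eq_mul,
      Complex.re_ofReal_mul, re_trace_spinSectorProj_mul_gibbsWeight_eq hP,
      re_trace_spinSectorProj_mul_gibbsWeight_eq hP] at h
    exact h

/-- **Spin-down transfer** (`b < |Λ|`, commutator bound with `c†_{x↓}`):
`(|Λ| − b) Re Z_β(H; a, b) ≤ e^{β|Λ|r/(|Λ|−b)} (b+1) Re Z_β(H; a, b+1)` and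
`(b+1) Re Z_β(H; a, b+1) ≤ e^{β|Λ|r/(b+1)} (|Λ| − b) Re Z_β(H; a, b)`. [cite: Ruelle1969, §3.4]
[cite: BratteliRobinsonII1997, §6.2.4] -/
theorem partitionFn_spinSector_transfer_down {H : Matrix (Finset (Orb Λ)) (Finset (Orb Λ)) ℂ}
    (hH : H.IsHermitian) (hP : PreservesSectors H) {r β : ℝ} (hβ : 0 ≤ β)
    (hc : ∀ x : Λ, ‖H * creation (orb x 1) - creation (orb x 1) * H‖ ≤ r) (a : ℕ) {b : ℕ}
    (hb : b < Fintype.card Λ) :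
    ((Fintype.card Λ : ℝ) - b) * (partitionFn β (spinSectorHamiltonian a b H)).re ≤
        Real.exp (β * (Fintype.card Λ * r) / ((Fintype.card Λ : ℝ) - b)) *
          (((b : ℝ) + 1) * (partitionFn β (spinSectorHamiltonian a (b + 1) H)).re) ∧
      ((b : ℝ) + 1) * (partitionFn β (spinSectorHamiltonian a (b + 1) H)).re ≤
        Real.exp (β * (Fintype.card Λ * r) / ((b : ℝ) + 1)) *
          (((Fintype.card Λ : ℝ) - b) * (partitionFn β (spinSectorHamiltonian a b H)).re) := by
  have hb0 : (0 : ℝ) < (Fintype.card Λ : ℝ) - b := by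
    have : (b : ℝ) + 1 ≤ Fintype.card Λ := by exact_mod_cast hb
    linarith
  have hann : ∀ x : Λ, ‖H * annihilation (orb x 1) - annihilation (orb x 1) * H‖ ≤ r := fun x =>
    norm_commutator_annihilation_le_of_creation hH _ (hc x)
  refine ⟨?_, ?_⟩
  · have h := orbitSum_transfer_gibbsWeight (O := Λ) hH (spinSectorProj_conjTranspose a b)
      (spinSectorProj_mul_self a b) (spinSectorProj_mul_comm_of_preservesSectors hP a b)
      (fun x => creation (orb x 1)) hb0 hβ (ρ := Fintype.card Λ * r)
      (sum_creation_down_conjTranspose_mul_mul_spinSectorProj a b)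
      (fun v => re_star_dotProduct_sum_commutator_mulVec_le H (fun x => creation (orb x 1))
        (fun x => norm_creation_le_one _) hc _)
    rw [sum_creation_down_mul_spinSectorProj_mul_conjTranspose, Matrix.smul_mul, Matrix.trace_smul, smul_eq_mul,
      Complex.re_ofReal_mul, re_trace_spinSectorProj_mul_gibbsWeight_eq hP,
      re_trace_spinSectorProj_mul_gibbsWeight_eq hP] at h
    exact h
  · have hb1 : (0 : ℝ) < (b : ℝ) + 1 := by positivity
    have h := orbitSum_transfer_gibbsWeight (O := Λ) hH (spinSectorProj_conjTranspose a (b + 1))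
      (spinSectorProj_mul_self a (b + 1)) (spinSectorProj_mul_comm_of_preservesSectors hP a (b + 1))
      (fun x => annihilation (orb x 1)) hb1 hβ (ρ := Fintype.card Λ * r)
      (sum_annihilation_down_conjTranspose_mul_mul_spinSectorProj a b)
      (fun v => re_star_dotProduct_sum_commutator_mulVec_le H (fun x => annihilation (orb x 1))
        (fun x => norm_annihilation_le_one _) hann _)
    rw [sum_annihilation_down_mul_spinSectorProj_mul_conjTranspose, Matrix.smul_mul, Matrix.trace_smul, smul_eq_mul,
      Complex.re_ofReal_mul, re_trace_spinSectorProj_mul_gibbsWeight_eq hP,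
      re_trace_spinSectorProj_mul_gibbsWeight_eq hP] at h
    exact h

end Transfer

/-! ### §3 The two-graph Hubbard Hamiltonian and the `t–t'` torus -/

namespace ThermodynamicLimit

section Hubbard

variable {Λ : Type*} [LinearOrder Λ] [Fintype Λ] (G G' : SimpleGraph Λ) [DecidableRel G.Adj] [DecidableRel G'.Adj]

/-- **Spin-up transfer for the two-graph Hubbard Hamiltonian** `H = hamiltonian G t U + hamiltonian G' t' U'`
(degrees `≤ Δ, Δ'`; `r = 2(2Δ+1)(2|t|+|U|) + 2(2Δ'+1)(2|t'|+|U'|)`), `β ≥ 0`, `a < |Λ|`: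
`(|Λ| − a) Z(a,b) ≤ e^{β|Λ|r/(|Λ|−a)} (a+1) Z(a+1,b)` and `(a+1) Z(a+1,b) ≤ e^{β|Λ|r/(a+1)} (|Λ| − a) Z(a,b)`.
[cite: Ruelle1969, §3.4] -/
theorem partitionFn_spinSector_twoGraph_transfer_up {Δ Δ' : ℕ} (hΔ : ∀ x : Λ, #{y | G.Adj x y} ≤ Δ)
    (hΔ' : ∀ x : Λ, #{y | G'.Adj x y} ≤ Δ') (t U t' U' : ℝ) {β : ℝ} (hβ : 0 ≤ β) {a : ℕ}
    (ha : a < Fintype.card Λ) (b : ℕ) :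
    ((Fintype.card Λ : ℝ) - a) *
          (partitionFn β (spinSectorHamiltonian a b (hamiltonian G t U + hamiltonian G' t' U'))).re ≤
        Real.exp (β * (Fintype.card Λ *
            ((2 * Δ + 1 : ℕ) * (2 * (2 * |t| + |U|)) + (2 * Δ' + 1 : ℕ) * (2 * (2 * |t'| + |U'|)))) /
            ((Fintype.card Λ : ℝ) - a)) *
          (((a : ℝ) + 1) *
            (partitionFn β (spinSectorHamiltonian (a + 1) b (hamiltonian G t U + hamiltonian G' t' U'))).re) ∧
      ((a : ℝ) + 1) *
          (partitionFn β (spinSectorHamiltonian (a + 1) b (hamiltonian G t U + hamiltonian G' t' U'))).re ≤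
        Real.exp (β * (Fintype.card Λ *
            ((2 * Δ + 1 : ℕ) * (2 * (2 * |t| + |U|)) + (2 * Δ' + 1 : ℕ) * (2 * (2 * |t'| + |U'|)))) /
            ((a : ℝ) + 1)) *
          (((Fintype.card Λ : ℝ) - a) *
            (partitionFn β (spinSectorHamiltonian a b (hamiltonian G t U + hamiltonian G' t' U'))).re) :=
  partitionFn_spinSector_transfer_up ((hamiltonian_isHermitian G t U).add (hamiltonian_isHermitian G' t' U'))
    ((preservesSectors_hamiltonian G t U).add (preservesSectors_hamiltonian G' t' U')) hβ
    (fun x => norm_commutator_twoGraph_creation_le G G' hΔ hΔ' t U t' U' x 0) ha b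

/-- **Spin-down transfer for the two-graph Hubbard Hamiltonian** (`b < |Λ|`). [cite: Ruelle1969, §3.4] -/
theorem partitionFn_spinSector_twoGraph_transfer_down {Δ Δ' : ℕ} (hΔ : ∀ x : Λ, #{y | G.Adj x y} ≤ Δ)
    (hΔ' : ∀ x : Λ, #{y | G'.Adj x y} ≤ Δ') (t U t' U' : ℝ) {β : ℝ} (hβ : 0 ≤ β) (a : ℕ) {b : ℕ}
    (hb : b < Fintype.card Λ) :
    ((Fintype.card Λ : ℝ) - b) *
          (partitionFn β (spinSectorHamiltonian a b (hamiltonian G t U + hamiltonian G' t' U'))).re ≤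
        Real.exp (β * (Fintype.card Λ *
            ((2 * Δ + 1 : ℕ) * (2 * (2 * |t| + |U|)) + (2 * Δ' + 1 : ℕ) * (2 * (2 * |t'| + |U'|)))) /
            ((Fintype.card Λ : ℝ) - b)) *
          (((b : ℝ) + 1) *
            (partitionFn β (spinSectorHamiltonian a (b + 1) (hamiltonian G t U + hamiltonian G' t' U'))).re) ∧
      ((b : ℝ) + 1) *
          (partitionFn β (spinSectorHamiltonian a (b + 1) (hamiltonian G t U + hamiltonian G' t' U'))).re ≤
        Real.exp (β * (Fintype.card Λ *
            ((2 * Δ + 1 : ℕ) * (2 * (2 * |t| + |U|)) + (2 * Δ' + 1 : ℕ) * (2 * (2 * |t'| + |U'|)))) /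
            ((b : ℝ) + 1)) *
          (((Fintype.card Λ : ℝ) - b) *
            (partitionFn β (spinSectorHamiltonian a b (hamiltonian G t U + hamiltonian G' t' U'))).re) :=
  partitionFn_spinSector_transfer_down ((hamiltonian_isHermitian G t U).add (hamiltonian_isHermitian G' t' U'))
    ((preservesSectors_hamiltonian G t U).add (preservesSectors_hamiltonian G' t' U')) hβ
    (fun x => norm_commutator_twoGraph_creation_le G G' hΔ hΔ' t U t' U' x 1) a hb

end Hubbard

section Torus

/-- The commutator rate of the `t–t'` torus: `2·9·(2|t|+|U|) + 2·9·(2|t'|+0) = 18(2|t|+|U|) + 36|t'|`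
(degrees `Δ = Δ' = 4`). [cite: LeBlancEtAl2015, eq. (1)] -/
theorem twoGraph_rate_torus_eq (t t' U : ℝ) :
    ((2 * 4 + 1 : ℕ) : ℝ) * (2 * (2 * |t| + |U|)) + ((2 * 4 + 1 : ℕ) : ℝ) * (2 * (2 * |t'| + |(0 : ℝ)|)) =
      18 * (2 * |t| + |U|) + 36 * |t'| := by
  rw [abs_zero]; push_cast; ring

/-- **Spin-up transfer on the `t–t'` torus** `ℤ/L₁ℤ × ℤ/L₂ℤ` (`|Λ| = L₁L₂`, `r = 18(2|t|+|U|) + 36|t'|`, `β ≥ 0`,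
`k < L₁L₂`): `(|Λ| − k) Z(k,l) ≤ e^{β|Λ|r/(|Λ|−k)} (k+1) Z(k+1,l)` and
`(k+1) Z(k+1,l) ≤ e^{β|Λ|r/(k+1)} (|Λ| − k) Z(k,l)`. [cite: Ruelle1969, §3.4] -/
theorem partitionFn_spinSector_hubbardRectTorusTT'_transfer_up (L₁ L₂ : ℕ) (t t' U : ℝ) {β : ℝ} (hβ : 0 ≤ β)
    {k : ℕ} (hk : k < L₁ * L₂) (l : ℕ) :
    (((L₁ * L₂ : ℕ) : ℝ) - k) * (partitionFn β (spinSectorHamiltonian k l (hubbardRectTorusTT' L₁ L₂ t t' U))).re ≤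
        Real.exp (β * ((L₁ * L₂ : ℕ) * (18 * (2 * |t| + |U|) + 36 * |t'|)) / (((L₁ * L₂ : ℕ) : ℝ) - k)) *
          (((k : ℝ) + 1) * (partitionFn β (spinSectorHamiltonian (k + 1) l (hubbardRectTorusTT' L₁ L₂ t t' U))).re) ∧
      ((k : ℝ) + 1) * (partitionFn β (spinSectorHamiltonian (k + 1) l (hubbardRectTorusTT' L₁ L₂ t t' U))).re ≤
        Real.exp (β * ((L₁ * L₂ : ℕ) * (18 * (2 * |t| + |U|) + 36 * |t'|)) / ((k : ℝ) + 1)) *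
          ((((L₁ * L₂ : ℕ) : ℝ) - k) * (partitionFn β (spinSectorHamiltonian k l (hubbardRectTorusTT' L₁ L₂ t t' U))).re) := by
  have hk' : k < Fintype.card (Fin L₁ ×ₗ Fin L₂) := by rw [card_rectSites]; exact hk
  have h := partitionFn_spinSector_twoGraph_transfer_up (fermionRectTorusGraph L₁ L₂) (fermionRectTorusDiagGraph L₁ L₂)
    (card_filter_fermionRectTorusGraph_adj_le L₁ L₂) (card_filter_fermionRectTorusDiagGraph_adj_le_four L₁ L₂)
    t U t' 0 hβ hk' l
  rw [twoGraph_rate_torus_eq, card_rectSites] at h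
  unfold hubbardRectTorusTT'
  exact h

/-- **Spin-down transfer on the `t–t'` torus** (`l < L₁L₂`). [cite: Ruelle1969, §3.4] -/
theorem partitionFn_spinSector_hubbardRectTorusTT'_transfer_down (L₁ L₂ : ℕ) (t t' U : ℝ) {β : ℝ} (hβ : 0 ≤ β)
    (k : ℕ) {l : ℕ} (hl : l < L₁ * L₂) :
    (((L₁ * L₂ : ℕ) : ℝ) - l) * (partitionFn β (spinSectorHamiltonian k l (hubbardRectTorusTT' L₁ L₂ t t' U))).re ≤
        Real.exp (β * ((L₁ * L₂ : ℕ) * (18 * (2 * |t| + |U|) + 36 * |t'|)) / (((L₁ * L₂ : ℕ) : ℝ) - l)) *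
          (((l : ℝ) + 1) * (partitionFn β (spinSectorHamiltonian k (l + 1) (hubbardRectTorusTT' L₁ L₂ t t' U))).re) ∧
      ((l : ℝ) + 1) * (partitionFn β (spinSectorHamiltonian k (l + 1) (hubbardRectTorusTT' L₁ L₂ t t' U))).re ≤
        Real.exp (β * ((L₁ * L₂ : ℕ) * (18 * (2 * |t| + |U|) + 36 * |t'|)) / ((l : ℝ) + 1)) *
          ((((L₁ * L₂ : ℕ) : ℝ) - l) * (partitionFn β (spinSectorHamiltonian k l (hubbardRectTorusTT' L₁ L₂ t t' U))).re) := by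
  have hl' : l < Fintype.card (Fin L₁ ×ₗ Fin L₂) := by rw [card_rectSites]; exact hl
  have h := partitionFn_spinSector_twoGraph_transfer_down (fermionRectTorusGraph L₁ L₂) (fermionRectTorusDiagGraph L₁ L₂)
    (card_filter_fermionRectTorusGraph_adj_le L₁ L₂) (card_filter_fermionRectTorusDiagGraph_adj_le_four L₁ L₂)
    t U t' 0 hβ k hl'
  rw [twoGraph_rate_torus_eq, card_rectSites] at h
  unfold hubbardRectTorusTT'
  exact h

/-- Logarithmic form of a transfer pair: from `m Z ≤ e^{c} m' Z'` and `m' Z' ≤ e^{c'} m Z` with `m, m', Z, Z' > 0`,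
`log(m/m') − c ≤ log Z' − log Z ≤ log(m/m') + c'`. [cite: Ruelle1969, §3.4] -/
theorem log_sub_log_mem_of_transfer {m m' Z Z' c c' : ℝ} (hm : 0 < m) (hm' : 0 < m') (hZ : 0 < Z) (hZ' : 0 < Z')
    (h₁ : m * Z ≤ Real.exp c * (m' * Z')) (h₂ : m' * Z' ≤ Real.exp c' * (m * Z)) :
    Real.log (m / m') - c ≤ Real.log Z' - Real.log Z ∧ Real.log Z' - Real.log Z ≤ Real.log (m / m') + c' := by
  have l₁ := Real.log_le_log (mul_pos hm hZ) h₁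
  have l₂ := Real.log_le_log (mul_pos hm' hZ') h₂
  rw [Real.log_mul hm.ne' hZ.ne', Real.log_mul (Real.exp_pos _).ne' (mul_pos hm' hZ').ne', Real.log_exp,
    Real.log_mul hm'.ne' hZ'.ne'] at l₁
  rw [Real.log_mul hm'.ne' hZ'.ne', Real.log_mul (Real.exp_pos _).ne' (mul_pos hm hZ).ne', Real.log_exp,
    Real.log_mul hm.ne' hZ.ne'] at l₂
  rw [Real.log_div hm.ne' hm'.ne']
  constructor <;> linarith

/-- **One up electron on the `t–t'` torus, logarithmic form** (`β ≥ 0`, `k + 1 ≤ L₁L₂`, `l ≤ L₁L₂`,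
`|Λ| = L₁L₂`, `r = 18(2|t|+|U|) + 36|t'|`):
`log((|Λ|−k)/(k+1)) − β|Λ|r/(|Λ|−k) ≤ log Z(k+1,l) − log Z(k,l) ≤ log((|Λ|−k)/(k+1)) + β|Λ|r/(k+1)` — the free
energy of one added electron is the ideal lattice-gas entropy up to `O(β)`. [cite: Ruelle1969, §3.4] -/
theorem log_partitionFn_spinSector_hubbardRectTorusTT'_succ_up_mem (L₁ L₂ : ℕ) (t t' U : ℝ) {β : ℝ} (hβ : 0 ≤ β)
    {k l : ℕ} (hk : k + 1 ≤ L₁ * L₂) (hl : l ≤ L₁ * L₂) :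
    Real.log (((((L₁ * L₂ : ℕ) : ℝ) - k)) / ((k : ℝ) + 1)) -
          β * ((L₁ * L₂ : ℕ) * (18 * (2 * |t| + |U|) + 36 * |t'|)) / (((L₁ * L₂ : ℕ) : ℝ) - k) ≤
        Real.log (partitionFn β (spinSectorHamiltonian (k + 1) l (hubbardRectTorusTT' L₁ L₂ t t' U))).re -
          Real.log (partitionFn β (spinSectorHamiltonian k l (hubbardRectTorusTT' L₁ L₂ t t' U))).re ∧
      Real.log (partitionFn β (spinSectorHamiltonian (k + 1) l (hubbardRectTorusTT' L₁ L₂ t t' U))).re -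
          Real.log (partitionFn β (spinSectorHamiltonian k l (hubbardRectTorusTT' L₁ L₂ t t' U))).re ≤
        Real.log (((((L₁ * L₂ : ℕ) : ℝ) - k)) / ((k : ℝ) + 1)) +
          β * ((L₁ * L₂ : ℕ) * (18 * (2 * |t| + |U|) + 36 * |t'|)) / ((k : ℝ) + 1) := by
  have hH := hubbardRectTorusTT'_isHermitian L₁ L₂ t t' U
  have hcard : Fintype.card (Fin L₁ ×ₗ Fin L₂) = L₁ * L₂ := card_rectSites L₁ L₂
  haveI : Nonempty (Subtype (spinConfig (Λ := Fin L₁ ×ₗ Fin L₂) k l)) :=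
    nonempty_spinConfig (by rw [hcard]; omega) (by rw [hcard]; exact hl)
  haveI : Nonempty (Subtype (spinConfig (Λ := Fin L₁ ×ₗ Fin L₂) (k + 1) l)) :=
    nonempty_spinConfig (by rw [hcard]; exact hk) (by rw [hcard]; exact hl)
  have hZ := partitionFn_spinSector_re_pos (a := k) (b := l) hH β
  have hZ' := partitionFn_spinSector_re_pos (a := k + 1) (b := l) hH β
  have hm : (0 : ℝ) < (((L₁ * L₂ : ℕ) : ℝ) - k) := by
    have : ((k : ℝ) + 1) ≤ ((L₁ * L₂ : ℕ) : ℝ) := by exact_mod_cast hk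
    linarith
  have hm' : (0 : ℝ) < (k : ℝ) + 1 := by positivity
  obtain ⟨h₁, h₂⟩ := partitionFn_spinSector_hubbardRectTorusTT'_transfer_up L₁ L₂ t t' U hβ (k := k) (by omega) l
  exact log_sub_log_mem_of_transfer hm hm' hZ hZ' h₁ h₂

/-- **One down electron on the `t–t'` torus, logarithmic form** (`l + 1 ≤ L₁L₂`, `k ≤ L₁L₂`).
[cite: Ruelle1969, §3.4] -/
theorem log_partitionFn_spinSector_hubbardRectTorusTT'_succ_down_mem (L₁ L₂ : ℕ) (t t' U : ℝ) {β : ℝ} (hβ : 0 ≤ β)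
    {k l : ℕ} (hk : k ≤ L₁ * L₂) (hl : l + 1 ≤ L₁ * L₂) :
    Real.log (((((L₁ * L₂ : ℕ) : ℝ) - l)) / ((l : ℝ) + 1)) -
          β * ((L₁ * L₂ : ℕ) * (18 * (2 * |t| + |U|) + 36 * |t'|)) / (((L₁ * L₂ : ℕ) : ℝ) - l) ≤
        Real.log (partitionFn β (spinSectorHamiltonian k (l + 1) (hubbardRectTorusTT' L₁ L₂ t t' U))).re -
          Real.log (partitionFn β (spinSectorHamiltonian k l (hubbardRectTorusTT' L₁ L₂ t t' U))).re ∧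
      Real.log (partitionFn β (spinSectorHamiltonian k (l + 1) (hubbardRectTorusTT' L₁ L₂ t t' U))).re -
          Real.log (partitionFn β (spinSectorHamiltonian k l (hubbardRectTorusTT' L₁ L₂ t t' U))).re ≤
        Real.log (((((L₁ * L₂ : ℕ) : ℝ) - l)) / ((l : ℝ) + 1)) +
          β * ((L₁ * L₂ : ℕ) * (18 * (2 * |t| + |U|) + 36 * |t'|)) / ((l : ℝ) + 1) := by
  have hH := hubbardRectTorusTT'_isHermitian L₁ L₂ t t' U
  have hcard : Fintype.card (Fin L₁ ×ₗ Fin L₂) = L₁ * L₂ := card_rectSites L₁ L₂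
  haveI : Nonempty (Subtype (spinConfig (Λ := Fin L₁ ×ₗ Fin L₂) k l)) :=
    nonempty_spinConfig (by rw [hcard]; exact hk) (by rw [hcard]; omega)
  haveI : Nonempty (Subtype (spinConfig (Λ := Fin L₁ ×ₗ Fin L₂) k (l + 1))) :=
    nonempty_spinConfig (by rw [hcard]; exact hk) (by rw [hcard]; exact hl)
  have hZ := partitionFn_spinSector_re_pos (a := k) (b := l) hH β
  have hZ' := partitionFn_spinSector_re_pos (a := k) (b := l + 1) hH β
  have hm : (0 : ℝ) < (((L₁ * L₂ : ℕ) : ℝ) - l) := by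
    have : ((l : ℝ) + 1) ≤ ((L₁ * L₂ : ℕ) : ℝ) := by exact_mod_cast hl
    linarith
  have hm' : (0 : ℝ) < (l : ℝ) + 1 := by positivity
  obtain ⟨h₁, h₂⟩ := partitionFn_spinSector_hubbardRectTorusTT'_transfer_down L₁ L₂ t t' U hβ k (l := l) (by omega)
  exact log_sub_log_mem_of_transfer hm hm' hZ hZ' h₁ h₂

/-- **One electron PAIR on the `t–t'` torus** (the diagonal step `(k,k) → (k+1,k+1)` used by the canonical
`t–t'` thermal convention; `k + 1 ≤ L₁L₂`):
`2 log((|Λ|−k)/(k+1)) − 2β|Λ|r/(|Λ|−k) ≤ log Z(k+1,k+1) − log Z(k,k) ≤ 2 log((|Λ|−k)/(k+1)) + 2β|Λ|r/(k+1)`.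
[cite: Ruelle1969, §3.4] -/
theorem log_partitionFn_spinSector_hubbardRectTorusTT'_succ_succ_mem (L₁ L₂ : ℕ) (t t' U : ℝ) {β : ℝ}
    (hβ : 0 ≤ β) {k : ℕ} (hk : k + 1 ≤ L₁ * L₂) :
    2 * Real.log (((((L₁ * L₂ : ℕ) : ℝ) - k)) / ((k : ℝ) + 1)) -
          2 * (β * ((L₁ * L₂ : ℕ) * (18 * (2 * |t| + |U|) + 36 * |t'|)) / (((L₁ * L₂ : ℕ) : ℝ) - k)) ≤
        Real.log (partitionFn β (spinSectorHamiltonian (k + 1) (k + 1) (hubbardRectTorusTT' L₁ L₂ t t' U))).re -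
          Real.log (partitionFn β (spinSectorHamiltonian k k (hubbardRectTorusTT' L₁ L₂ t t' U))).re ∧
      Real.log (partitionFn β (spinSectorHamiltonian (k + 1) (k + 1) (hubbardRectTorusTT' L₁ L₂ t t' U))).re -
          Real.log (partitionFn β (spinSectorHamiltonian k k (hubbardRectTorusTT' L₁ L₂ t t' U))).re ≤
        2 * Real.log (((((L₁ * L₂ : ℕ) : ℝ) - k)) / ((k : ℝ) + 1)) +
          2 * (β * ((L₁ * L₂ : ℕ) * (18 * (2 * |t| + |U|) + 36 * |t'|)) / ((k : ℝ) + 1)) := by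
  obtain ⟨a₁, a₂⟩ := log_partitionFn_spinSector_hubbardRectTorusTT'_succ_up_mem L₁ L₂ t t' U hβ (l := k) hk (by omega)
  obtain ⟨b₁, b₂⟩ := log_partitionFn_spinSector_hubbardRectTorusTT'_succ_down_mem L₁ L₂ t t' U hβ (k := k + 1) hk hk
  constructor <;> linarith

end Torus

end ThermodynamicLimit

end Literature.MathematicalPhysics.QuantumLattice
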